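import Literature.Geometry.Riemannian.RiemannianDistanceScaling
import HarnessLib

/-!
# Riemannian volume under constant rescaling `g ↦ c • g`
(topic `Geometry/Riemannian`)

Companion to `RiemannianDistanceScaling.lean` (`d_{c g} = √c · d_g`): the Riemannian volume
measure — in the tree's rendering the Euclidean-normalised `dim M`-dimensional Hausdorff measure
of the Riemannian distance (`PseudoRiemannianMetric.riemVolume`, `Volume.lean`) — scales by
`(√c)^{dim M}` under `g ↦ c • g`, `c > 0`:
* `riemVolume_constSmul_le` (one-sided, from `LipschitzOnWith.euclideanHausdorffMeasure_image_le`
  for the identity `(M, d_g) → (M, d_{c g})`, which is `√c`-Lipschitz), and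
* `vol_constSmul`: `Vol_{c g}(s) = (√c)^{dim M} · Vol_g(s)` (the reverse bound being the first one
  for `c g` and `c⁻¹`); in dimension `4`, `Vol_{c g} = c² Vol_g` (`vol_constSmul_four`).
This is the last of the pointwise identities making the canonical neighbourhood assumption of
Chen–Zhu 2006 (§5, p. 26: "`(C₂ R(x,t))⁻² ≤ Vol_t(B)`") scale-invariant, recorded for the
normalisation "we may assume `T₀ > 1`" (p. 26). Federer 1969, §2.10.11 (Hausdorff measure under
Lipschitz maps).

## References

* H. Federer, *Geometric Measure Theory* (1969), §2.10.11, §3.2.46. [Federer1969]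
* B.-L. Chen, X.-P. Zhu, arXiv:math/0504478, §5, p. 26. [ChenZhu2006]
-/

noncomputable section

open Bundle Set Filter Manifold MeasureTheory
open scoped Manifold ContDiff Topology ENNReal NNReal

namespace Literature.Geometry.Riemannian

open Literature.Geometry.Lorentzian (PseudoRiemannianMetric riemannianMeasure riemannianVolume)
open Literature.Geometry.Lorentzian.PseudoRiemannianMetric

variable {E : Type*} [NormedAddCommGroup E] [NormedSpace ℝ E] {H : Type*} [TopologicalSpace H]
  {I : ModelWithCorners ℝ E H} {M : Type*} [TopologicalSpace M] [ChartedSpace H M]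
  [IsManifold I ∞ M] {n : ℕ∞ω} [FiniteDimensional ℝ E] [T3Space M] [MeasurableSpace M]
  [BorelSpace M] {g : PseudoRiemannianMetric I n E (TangentSpace I : M → Type _)}

/-- **Lipschitz maps and the Euclidean Hausdorff measure**: if `f : X → Y` is `C`-Lipschitz then
`μHE[d] (f '' s) ≤ C^d · μHE[d] s` (Mathlib's `LipschitzWith.hausdorffMeasure_image_le` for
`μH[d]`; `μHE[d]` is the same constant multiple of `μH[d]` on every space; cf. the `LipschitzOnWith`
form in `Literature/MeasureTheory/Hausdorff/SphericalCap.lean`). Federer 1969, §2.10.11.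
[cite: Federer1969, §2.10.11] -/
theorem lipschitzWith_euclideanHausdorffMeasure_image_le {X Y : Type*} [EMetricSpace X]
    [MeasurableSpace X] [BorelSpace X] [EMetricSpace Y] [MeasurableSpace Y] [BorelSpace Y]
    {C : ℝ≥0} {f : X → Y} (h : LipschitzWith C f) (d : ℕ) (s : Set X) :
    (μHE[d] : Measure Y) (f '' s) ≤ (C : ℝ≥0∞) ^ d * (μHE[d] : Measure X) s := by
  have h1 := h.hausdorffMeasure_image_le (d := (d : ℝ)) (Nat.cast_nonneg d) s
  rw [ENNReal.rpow_natCast] at h1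
  simp only [Measure.euclideanHausdorffMeasure_def, Measure.smul_apply, ENNReal.smul_def,
    smul_eq_mul]
  calc _ ≤ (Measure.addHaarScalarFactor (volume : Measure (EuclideanSpace ℝ (Fin d))) μH[d] : ℝ≥0∞) *
        ((C : ℝ≥0∞) ^ d * μH[d] s) := by gcongr
    _ = _ := by ring

/-- **One-sided volume comparison under rescaling**: `Vol_{c g}(s) ≤ (√c)^{dim M} Vol_g(s)` for
`c > 0` — the identity `(M, d_g) → (M, d_{c g})` is `√c`-Lipschitz (`edist_constSmul`), and
`d`-dimensional Hausdorff measure grows at most by `K^d` under `K`-Lipschitz maps (Federer 1969,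
§2.10.11). [cite: Federer1969, §2.10.11] -/
theorem _root_.Literature.Geometry.Lorentzian.PseudoRiemannianMetric.riemVolume_constSmul_le
    (hg : g.IsRiemannian) {c : ℝ} (hc : 0 < c) (s : Set M) :
    (g.constSmul c hc.ne').riemVolume s ≤
      ENNReal.ofReal (Real.sqrt c) ^ Module.finrank ℝ E * g.riemVolume s := by
  rw [riemVolume_eq (hg.constSmul hc), riemVolume_eq hg]
  -- the two Riemannian distance structures on `M` (in the form used by `riemannianVolume`)
  let X₁ : EMetricSpace M := by
    letI : RiemannianBundle (fun x : M ↦ TangentSpace I x) :=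
      ⟨(g.toContMDiffRiemannianMetric hg).toContinuousRiemannianMetric.toRiemannianMetric⟩
    exact EMetricSpace.ofRiemannianMetric I M
  let X₂ : EMetricSpace M := by
    letI : RiemannianBundle (fun x : M ↦ TangentSpace I x) :=
      ⟨((g.constSmul c hc.ne').toContMDiffRiemannianMetric
        (hg.constSmul hc)).toContinuousRiemannianMetric.toRiemannianMetric⟩
    exact EMetricSpace.ofRiemannianMetric I M
  -- the Lipschitz constant `√c`
  let K : ℝ≥0 := ⟨Real.sqrt c, Real.sqrt_nonneg c⟩
  have hK : (K : ℝ≥0∞) = ENNReal.ofReal (Real.sqrt c) :=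
    (ENNReal.ofReal_eq_coe_nnreal (Real.sqrt_nonneg c)).symm
  -- the identity is `√c`-Lipschitz from `d_g` to `d_{c g}`
  have hL : @LipschitzWith M M X₁.toPseudoEMetricSpace X₂.toPseudoEMetricSpace K id := by
    intro x y
    show (g.constSmul c hc.ne').edist (hg.constSmul hc) x y ≤ (K : ℝ≥0∞) * g.edist hg x y
    rw [hK, edist_constSmul hg hc]
  have key := @lipschitzWith_euclideanHausdorffMeasure_image_le M M X₁ _ ‹BorelSpace M› X₂ _
    ‹BorelSpace M› K id hL (Module.finrank ℝ E) s
  rw [image_id, hK] at key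
  exact key

/-- **Riemannian volume under rescaling**: `Vol_{c g}(s) = (√c)^{dim M} · Vol_g(s)` for `c > 0`
(`dV_{c g} = c^{n/2} dV_g`; both sides are the junk value `0` if `g` is not Riemannian).
[cite: Federer1969, §2.10.11 and §3.2.46] -/
theorem _root_.Literature.Geometry.Lorentzian.PseudoRiemannianMetric.vol_constSmul
    (g : PseudoRiemannianMetric I n E (TangentSpace I : M → Type _)) {c : ℝ} (hc : 0 < c)
    (s : Set M) :
    (g.constSmul c hc.ne').vol s = ENNReal.ofReal (Real.sqrt c) ^ Module.finrank ℝ E * g.vol s := by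
  by_cases hg : g.IsRiemannian
  swap
  · have hg' : ¬ (g.constSmul c hc.ne').IsRiemannian := (isRiemannian_constSmul_iff hc).not.mpr hg
    simp [PseudoRiemannianMetric.vol, PseudoRiemannianMetric.riemVolume, hg, hg']
  refine le_antisymm (riemVolume_constSmul_le hg hc s) ?_
  -- reverse: the first bound for `c g` and `c⁻¹`
  have hc' : 0 < c⁻¹ := inv_pos.mpr hc
  have h := riemVolume_constSmul_le (hg.constSmul hc) hc' s
  have hgg : (g.constSmul c hc.ne').constSmul c⁻¹ hc'.ne' = g := g.constSmul_inv_constSmul c hc.ne'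
  rw [hgg] at h
  set k : ℝ≥0∞ := ENNReal.ofReal (Real.sqrt c) ^ Module.finrank ℝ E with hk
  set k' : ℝ≥0∞ := ENNReal.ofReal (Real.sqrt c⁻¹) ^ Module.finrank ℝ E with hk'
  have hkk : k * k' = 1 := by
    rw [hk, hk', ← mul_pow, ← ENNReal.ofReal_mul (Real.sqrt_nonneg _), ← Real.sqrt_mul hc.le,
      mul_inv_cancel₀ hc.ne', Real.sqrt_one, ENNReal.ofReal_one, one_pow]
  calc k * g.vol s ≤ k * (k' * (g.constSmul c hc.ne').riemVolume s) := by gcongr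
    _ = (g.constSmul c hc.ne').vol s := by rw [← mul_assoc, hkk, one_mul]

/-- In dimension `4`: `Vol_{c g} = c² · Vol_g`. [folklore] -/
theorem _root_.Literature.Geometry.Lorentzian.PseudoRiemannianMetric.vol_constSmul_four
    {M : Type*} [TopologicalSpace M] [ChartedSpace (EuclideanSpace ℝ (Fin 4)) M]
    [IsManifold (𝓡 4) ∞ M] [T3Space M] [MeasurableSpace M] [BorelSpace M]
    (g : PseudoRiemannianMetric (𝓡 4) n (EuclideanSpace ℝ (Fin 4)) (TangentSpace (𝓡 4) : M → Type _))
    {c : ℝ} (hc : 0 < c) (s : Set M) :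
    (g.constSmul c hc.ne').vol s = ENNReal.ofReal (c ^ 2) * g.vol s := by
  rw [vol_constSmul g hc s, finrank_euclideanSpace, Fintype.card_fin, ← ENNReal.ofReal_pow
    (Real.sqrt_nonneg c)]
  congr 2
  rw [show (4 : ℕ) = 2 * 2 from rfl, pow_mul, Real.sq_sqrt hc.le]

end Literature.Geometry.Riemannian

end
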